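import Mathlib
import Literature.Analysis.FluidPDE.BiotSavartBounds
import Literature.Analysis.FluidPDE.AxisymNoSwirlScaleInvariantBounds
import Summits.NavierStokesRegularity.NavierStokesRegularity.Theorems.L3TimeExponentPincerWeakLayerCake
import HarnessLib.Audit
import HarnessLib

/-!
# L3TimeExponentPincer — the kinematic `L³` floor `‖v‖₂² ≤ C ‖curl v‖₁ ‖v‖₃`
# (weak Young `L¹ → L^{3/2,∞}` for the Biot–Savart law)

Support kernel for the crux `L3CascadeJaw` (route `L3TimeExponentPincer`, item
stmt-NavierStokesRegularity-19499), serving the PERSISTENCE LEMMA `LpPersistence 3 (1/2) 2` of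
`L3TimeExponentPincerQuantJaw` (ROUND-11 of seat nsreg-p2: "the jaw has no constant"): the step
that turns an ENERGY lower bound and a VORTICITY-MASS upper bound into an `L³` lower bound.
The memo's chain (iv)–(vi) (`‖u‖_{12/7} ≤ C_HLS ‖ω‖_{12/11}`, Hardy–Littlewood–Sobolev) is replaced
by its elementary endpoint:

* `meas_biotSavart_gt_le` — **weak Young `L¹ → L^{3/2,∞}` for the Biot–Savart law**: for a
  vorticity `w` with `∫‖w‖ = A < ∞`, `|{‖K₃ ∗ w‖ > s}| ≤ (2/√(2π)) A^{3/2} s^{-3/2}` for every `s > 0`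
  (kernel bound `‖K₃(z)h‖ ≤ (4π)⁻¹‖h‖|z|⁻²`, near/far split of `|z|⁻²` at the scale
  `ρ = √(A/(2πs))`: the far part is `≤ ρ⁻² A = 2πs` pointwise, the near part has integral `4πρ A`
  (Tonelli, `∫_{|z|<ρ}|z|⁻² = 4πρ`) and is handled by Markov);
* `lintegral_cube_biotSavart_ge` — with the layer cake of `L3TimeExponentPincerWeakLayerCake`:
  `∫|K₃∗w|² ≥ X` ⟹ `∫|K₃∗w|³ ≥ π X³/(512 A³)`, i.e. `‖v‖₃ ≥ (π/512)^{1/3} ‖v‖₂²/‖curl v‖₁`;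
* `lintegral_cube_ge_of_energy_of_vorticityMass` / `eLpNorm_three_ge_of_energy_of_vorticityMass`
  — the same along a Tao-class solution whose vorticity slice is integrable (the slice IS the
  Biot–Savart velocity of its vorticity, `IsTaoSolutionOn.biotSavart_curl_eq`).

For a vortex ring of speed `U` and size `ℓ` (`‖u‖₂² ≍ U²ℓ³`, `‖ω‖₁ ≍ Uℓ²`) the floor is `≍ Uℓ`,
the energy-level `L³` floor of the memo. WHAT THIS IS NOT: not a statement about Navier–Stokes
dynamics — a kinematic inequality for Biot–Savart velocities; the persistence lemma itself
(dynamics of the ring) is NOT proved here.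
-/

namespace Summit.NavierStokesRegularity.NavierStokesRegularity.Theorems.L3TimeExponentPincerVorticityL3Floor

open MeasureTheory Set Metric Real Literature.Analysis.FluidPDE
open Summit.NavierStokesRegularity.NavierStokesRegularity.Theorems.L3TimeExponentPincerWeakLayerCake
open scoped ENNReal NNReal

/-! ### §1  Weak Young `L¹ → L^{3/2,∞}` for the Biot–Savart law -/

/-- The near-field functional `N_ρ(x) = ∫ ‖w(y)‖ 1_{|x−y|<ρ} |x−y|⁻² dy` has total integral
`∫ N_ρ = 4πρ ∫‖w‖` (Tonelli and `∫_{|z|<ρ}|z|⁻² dz = 4πρ`). -/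
theorem lintegral_nearField_eq {w : (EuclideanSpace ℝ (Fin 3)) → (EuclideanSpace ℝ (Fin 3))} (hwm : Measurable fun y => ‖w y‖ₑ) {ρ : ℝ}
    (hρ : 0 ≤ ρ) :
    ∫⁻ x, ∫⁻ y, ‖w y‖ₑ * ENNReal.ofReal (kernelMajorant ρ (x - y)) =
      (∫⁻ y, ‖w y‖ₑ) * ENNReal.ofReal (4 * π * ρ) := by
  have hk : Measurable fun z : (EuclideanSpace ℝ (Fin 3)) => ENNReal.ofReal (kernelMajorant ρ z) :=
    (measurable_kernelMajorant ρ).ennreal_ofReal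
  have hF : Measurable (Function.uncurry fun (x y : (EuclideanSpace ℝ (Fin 3))) =>
      ‖w y‖ₑ * ENNReal.ofReal (kernelMajorant ρ (x - y))) :=
    (hwm.comp measurable_snd).mul (hk.comp (measurable_fst.sub measurable_snd))
  rw [lintegral_lintegral_swap hF.aemeasurable]
  have hinner : ∀ y : (EuclideanSpace ℝ (Fin 3)), ∫⁻ x, ‖w y‖ₑ * ENNReal.ofReal (kernelMajorant ρ (x - y)) =
      ‖w y‖ₑ * ENNReal.ofReal (4 * π * ρ) := by
    intro y
    have hkx : Measurable fun x : (EuclideanSpace ℝ (Fin 3)) => ENNReal.ofReal (kernelMajorant ρ (x - y)) :=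
      hk.comp (measurable_id.sub measurable_const)
    rw [lintegral_const_mul _ hkx,
      lintegral_sub_right_eq_self (fun z => ENNReal.ofReal (kernelMajorant ρ z)) y,
      lintegral_kernelMajorant hρ]
  simp_rw [hinner]
  rw [lintegral_mul_const _ hwm]

/-- The near-field functional is measurable in `x`. -/
theorem measurable_nearField {w : (EuclideanSpace ℝ (Fin 3)) → (EuclideanSpace ℝ (Fin 3))} (hwm : Measurable fun y => ‖w y‖ₑ) (ρ : ℝ) :
    Measurable fun x : (EuclideanSpace ℝ (Fin 3)) => ∫⁻ y, ‖w y‖ₑ * ENNReal.ofReal (kernelMajorant ρ (x - y)) := by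
  have hk : Measurable fun z : (EuclideanSpace ℝ (Fin 3)) => ENNReal.ofReal (kernelMajorant ρ z) :=
    (measurable_kernelMajorant ρ).ennreal_ofReal
  have hF : Measurable (Function.uncurry fun (x y : (EuclideanSpace ℝ (Fin 3))) =>
      ‖w y‖ₑ * ENNReal.ofReal (kernelMajorant ρ (x - y))) :=
    (hwm.comp measurable_snd).mul (hk.comp (measurable_fst.sub measurable_snd))
  exact hF.lintegral_prod_right'

/-- **Near/far splitting of the Biot–Savart integral** at scale `ρ > 0`:
`‖(K₃ ∗ w)(x)‖ ≤ (4π)⁻¹ (N_ρ(x) + ρ⁻² ∫‖w‖)` (kernel bound `‖K₃(z)h‖ ≤ (4π)⁻¹‖h‖|z|⁻²`,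
`|z|⁻² ≤ 1_{|z|<ρ}|z|⁻² + ρ⁻²`, and `‖∫f‖ₑ ≤ ∫⁻‖f‖ₑ`). -/
theorem enorm_biotSavart_le_nearField_add {w : (EuclideanSpace ℝ (Fin 3)) → (EuclideanSpace ℝ (Fin 3))} (hwm : Measurable fun y => ‖w y‖ₑ)
    (x : (EuclideanSpace ℝ (Fin 3))) {ρ : ℝ} (hρ : 0 < ρ) :
    ‖biotSavart w x‖ₑ ≤ ENNReal.ofReal ((4 * π)⁻¹) *
      ((∫⁻ y, ‖w y‖ₑ * ENNReal.ofReal (kernelMajorant ρ (x - y))) +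
        ENNReal.ofReal ((ρ ^ 2)⁻¹) * ∫⁻ y, ‖w y‖ₑ) := by
  have hc : (0 : ℝ) ≤ (4 * π)⁻¹ := by positivity
  have hR : 0 < ρ / 4 := by positivity
  -- pointwise bound on the integrand
  have hpt : ∀ y, ‖biotSavartKernel (x - y) (w y)‖ₑ ≤ ENNReal.ofReal ((4 * π)⁻¹) *
      (‖w y‖ₑ * ENNReal.ofReal (kernelMajorant ρ (x - y)) +
        ENNReal.ofReal ((ρ ^ 2)⁻¹) * ‖w y‖ₑ) := by
    intro y
    have hsplit : (‖x - y‖ ^ 2)⁻¹ ≤ kernelMajorant ρ (x - y) + (ρ ^ 2)⁻¹ := by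
      have h := norm_sub_sq_inv_le_kernelMajorant_add hR x y
      have e1 : 4 * (ρ / 4) = ρ := by ring
      have e2 : 16 * (ρ / 4) ^ 2 = ρ ^ 2 := by ring
      rwa [e1, e2] at h
    have h1 : ‖biotSavartKernel (x - y) (w y)‖ ≤
        (4 * π)⁻¹ * (‖w y‖ * kernelMajorant ρ (x - y) + (ρ ^ 2)⁻¹ * ‖w y‖) := by
      calc ‖biotSavartKernel (x - y) (w y)‖ ≤ (4 * π)⁻¹ * ‖w y‖ * (‖x - y‖ ^ 2)⁻¹ :=
            norm_biotSavartKernel_le _ _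
        _ ≤ (4 * π)⁻¹ * ‖w y‖ * (kernelMajorant ρ (x - y) + (ρ ^ 2)⁻¹) := by
            gcongr
        _ = (4 * π)⁻¹ * (‖w y‖ * kernelMajorant ρ (x - y) + (ρ ^ 2)⁻¹ * ‖w y‖) := by ring
    rw [← ofReal_norm (biotSavartKernel _ _), ← ofReal_norm (w y),
      ← ENNReal.ofReal_mul (norm_nonneg _), ← ENNReal.ofReal_mul (by positivity),
      ← ENNReal.ofReal_add (mul_nonneg (norm_nonneg _) (kernelMajorant_nonneg _ _))
        (mul_nonneg (by positivity) (norm_nonneg _)), ← ENNReal.ofReal_mul hc]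
    exact ENNReal.ofReal_le_ofReal h1
  have hk : Measurable fun y : (EuclideanSpace ℝ (Fin 3)) => ENNReal.ofReal (kernelMajorant ρ (x - y)) :=
    ((measurable_kernelMajorant ρ).comp (measurable_const.sub measurable_id)).ennreal_ofReal
  have hmk : Measurable fun y : (EuclideanSpace ℝ (Fin 3)) => ‖w y‖ₑ * ENNReal.ofReal (kernelMajorant ρ (x - y)) :=
    hwm.mul hk
  rw [biotSavart]
  refine (enorm_integral_le_lintegral_enorm _).trans ((lintegral_mono hpt).trans ?_)
  rw [lintegral_const_mul' _ _ ENNReal.ofReal_ne_top, lintegral_add_left hmk,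
    lintegral_const_mul' _ _ ENNReal.ofReal_ne_top]

/-- If the vorticity has zero mass, `∫‖w‖ = 0`, its Biot–Savart velocity vanishes identically. -/
theorem biotSavart_eq_zero_of_lintegral_eq_zero {w : (EuclideanSpace ℝ (Fin 3)) → (EuclideanSpace ℝ (Fin 3))}
    (hwm : Measurable fun y => ‖w y‖ₑ) (h0 : ∫⁻ y, ‖w y‖ₑ = 0) (x : (EuclideanSpace ℝ (Fin 3))) :
    biotSavart w x = 0 := by
  have hae : ∀ᵐ y ∂(volume : Measure (EuclideanSpace ℝ (Fin 3))), ‖w y‖ₑ = 0 := (lintegral_eq_zero_iff hwm).1 h0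
  rw [biotSavart]
  refine integral_eq_zero_of_ae (hae.mono fun y hy => ?_)
  have : w y = 0 := by simpa using hy
  simp [this]

/-- **Weak Young `L¹ → L^{3/2,∞}` for the Biot–Savart law.** For a vorticity `w` with
`A = ∫‖w‖ < ∞` and every `s > 0`,
`|{x : ‖(K₃ ∗ w)(x)‖ > s}| ≤ (2/√(2π)) · A^{3/2} · s^{-3/2}` (`2/√(2π) = √(2/π) ≈ 0.8`)
(near/far split at `ρ = √(A/(2πs))`: the far part contributes at most `s/2` to `‖K₃ ∗ w‖`
pointwise, the near part is caught by Markov's inequality and `∫ N_ρ = 4πρ A`). -/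
theorem meas_biotSavart_gt_le {w : (EuclideanSpace ℝ (Fin 3)) → (EuclideanSpace ℝ (Fin 3))} (hwm : Measurable fun y => ‖w y‖ₑ)
    (hA : ∫⁻ y, ‖w y‖ₑ < ⊤) {s : ℝ} (hs : 0 < s) :
    volume {x | s < ‖biotSavart w x‖} ≤
      ENNReal.ofReal ((2 / Real.sqrt (2 * π)) * (∫⁻ y, ‖w y‖ₑ).toReal ^ (3 / 2 : ℝ) *
        s ^ (-(3 / 2 : ℝ))) := by
  set Ae : ℝ≥0∞ := ∫⁻ y, ‖w y‖ₑ with hAe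
  set A : ℝ := Ae.toReal with hAdef
  have hA0 : 0 ≤ A := ENNReal.toReal_nonneg
  rcases hA0.eq_or_lt with hAz | hApos
  · -- zero vorticity mass: the velocity vanishes, the level set is empty
    have hAe0 : Ae = 0 := by
      have := (ENNReal.toReal_eq_zero_iff Ae).1 hAz.symm
      exact this.resolve_right hA.ne
    have hempty : {x | s < ‖biotSavart w x‖} = ∅ := by
      ext x
      simp only [mem_setOf_eq, mem_empty_iff_false, iff_false, not_lt]
      rw [biotSavart_eq_zero_of_lintegral_eq_zero hwm hAe0 x, norm_zero]
      exact hs.le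
    rw [hempty, measure_empty]
    exact zero_le
  -- positive mass: split at `ρ = √(A/(2πs))`
  set ρ : ℝ := Real.sqrt (A / (2 * π * s)) with hρdef
  have hq : 0 < A / (2 * π * s) := by positivity
  have hρ : 0 < ρ := Real.sqrt_pos.2 hq
  have hρsq : ρ ^ 2 = A / (2 * π * s) := Real.sq_sqrt hq.le
  have hAeq : Ae = ENNReal.ofReal A := (ENNReal.ofReal_toReal hA.ne).symm
  set N : (EuclideanSpace ℝ (Fin 3)) → ℝ≥0∞ := fun x => ∫⁻ y, ‖w y‖ₑ * ENNReal.ofReal (kernelMajorant ρ (x - y)) with hN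
  have hNm : Measurable N := measurable_nearField hwm ρ
  -- the far part is `≤ s/2` after the factor `(4π)⁻¹`
  have hfar : ENNReal.ofReal ((4 * π)⁻¹) * (ENNReal.ofReal ((ρ ^ 2)⁻¹) * Ae) =
      ENNReal.ofReal (s / 2) := by
    rw [hAeq, ← ENNReal.ofReal_mul (by positivity), ← ENNReal.ofReal_mul (by positivity)]
    congr 1
    rw [hρsq]
    field_simp
    ring
  -- the level set is inside `{N ≥ 2πs}`
  have hsub : {x | s < ‖biotSavart w x‖} ⊆ {x | ENNReal.ofReal (2 * π * s) ≤ N x} := by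
    intro x hx
    simp only [mem_setOf_eq] at hx ⊢
    have h1 : ENNReal.ofReal s < ‖biotSavart w x‖ₑ := by
      rw [← ofReal_norm]
      exact (ENNReal.ofReal_lt_ofReal_iff (hs.trans hx)).2 hx
    have h2 := enorm_biotSavart_le_nearField_add hwm x hρ
    rw [mul_add, hfar] at h2
    have h3 : ENNReal.ofReal s < ENNReal.ofReal ((4 * π)⁻¹) * N x + ENNReal.ofReal (s / 2) :=
      h1.trans_le h2
    -- `s = s/2 + s/2`
    have hs2 : ENNReal.ofReal s = ENNReal.ofReal (s / 2) + ENNReal.ofReal (s / 2) := by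
      rw [← ENNReal.ofReal_add (by positivity) (by positivity)]
      congr 1
      ring
    rw [hs2] at h3
    have h4 : ENNReal.ofReal (s / 2) < ENNReal.ofReal ((4 * π)⁻¹) * N x := by
      by_contra hle
      rw [not_lt] at hle
      have := add_le_add hle (le_refl (ENNReal.ofReal (s / 2)))
      exact absurd (h3.trans_le this) (lt_irrefl _)
    -- divide by `(4π)⁻¹`
    have h5 : ENNReal.ofReal (2 * π * s) = ENNReal.ofReal (s / 2) / ENNReal.ofReal ((4 * π)⁻¹) := by
      rw [← ENNReal.ofReal_div_of_pos (by positivity)]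
      congr 1
      field_simp
      ring
    rw [h5]
    refine (ENNReal.div_le_iff (by rw [ne_eq, ENNReal.ofReal_eq_zero, not_le]; positivity)
      ENNReal.ofReal_ne_top).2 ?_
    rw [mul_comm]
    exact h4.le
  -- Markov on `N`, `∫ N = 4πρ A`
  have hmarkov : volume {x | ENNReal.ofReal (2 * π * s) ≤ N x} ≤
      (∫⁻ x, N x) / ENNReal.ofReal (2 * π * s) :=
    meas_ge_le_lintegral_div hNm.aemeasurable
      (by rw [ne_eq, ENNReal.ofReal_eq_zero, not_le]; positivity) ENNReal.ofReal_ne_top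
  have hNint : ∫⁻ x, N x = Ae * ENNReal.ofReal (4 * π * ρ) := lintegral_nearField_eq hwm hρ.le
  calc volume {x | s < ‖biotSavart w x‖}
      ≤ volume {x | ENNReal.ofReal (2 * π * s) ≤ N x} := measure_mono hsub
    _ ≤ (∫⁻ x, N x) / ENNReal.ofReal (2 * π * s) := hmarkov
    _ = ENNReal.ofReal (A * (4 * π * ρ) / (2 * π * s)) := by
        rw [hNint, hAeq, ← ENNReal.ofReal_mul hApos.le, ENNReal.ofReal_div_of_pos (by positivity)]
    _ = ENNReal.ofReal ((2 / Real.sqrt (2 * π)) * A ^ (3 / 2 : ℝ) * s ^ (-(3 / 2 : ℝ))) := by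
        congr 1
        -- `A · 4πρ/(2πs) = 2Aρ/s` with `ρ = √A/(√(2π) √s)`
        have e1 : A * (4 * π * ρ) / (2 * π * s) = 2 * A * ρ / s := by
          field_simp
          ring
        have hA32 : A ^ (3 / 2 : ℝ) = A * Real.sqrt A := by
          rw [show (3 / 2 : ℝ) = 1 + 1 / 2 by norm_num, Real.rpow_add hApos, Real.rpow_one,
            Real.sqrt_eq_rpow]
        have hs32 : s ^ (-(3 / 2 : ℝ)) = (s * Real.sqrt s)⁻¹ := by
          rw [Real.rpow_neg hs.le, show (3 / 2 : ℝ) = 1 + 1 / 2 by norm_num, Real.rpow_add hs,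
            Real.rpow_one, Real.sqrt_eq_rpow]
        have hρ' : ρ = Real.sqrt A / (Real.sqrt (2 * π) * Real.sqrt s) := by
          rw [hρdef, Real.sqrt_div hApos.le, Real.sqrt_mul (by positivity)]
        have hπ : Real.sqrt (2 * π) ≠ 0 := (Real.sqrt_pos.2 (by positivity)).ne'
        have hss : Real.sqrt s ≠ 0 := (Real.sqrt_pos.2 hs).ne'
        rw [e1, hA32, hs32, hρ']
        field_simp

/-! ### §2  The `L³` floor of a Biot–Savart velocity -/

/-- **The kinematic `L³` floor.** If `v = K₃ ∗ w` with `A = ∫‖w‖ ∈ (0, ∞)` has energy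
`∫|v|² ≥ X > 0`, then `∫|v|³ ≥ π X³/(512 A³)`; equivalently `‖v‖₃ ≥ (π/512)^{1/3} X/A`, i.e.
`‖v‖₂² ≤ (512/π)^{1/3} ‖w‖₁ ‖v‖₃`. -/
theorem lintegral_cube_biotSavart_ge {w : (EuclideanSpace ℝ (Fin 3)) → (EuclideanSpace ℝ (Fin 3))} (hwm : Measurable fun y => ‖w y‖ₑ)
    (hvm : AEStronglyMeasurable (biotSavart w) volume)
    {A : ℝ} (hA : 0 < A) (hAw : ∫⁻ y, ‖w y‖ₑ ≤ ENNReal.ofReal A)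
    {X : ℝ} (hX : 0 < X) (hfloor : ENNReal.ofReal X ≤ ∫⁻ x, ‖biotSavart w x‖ₑ ^ 2) :
    ENNReal.ofReal (π * X ^ 3 / (512 * A ^ 3)) ≤ ∫⁻ x, ‖biotSavart w x‖ₑ ^ (3 : ℕ) := by
  have hAtop : ∫⁻ y, ‖w y‖ₑ < ⊤ := hAw.trans_lt ENNReal.ofReal_lt_top
  have hA' : (∫⁻ y, ‖w y‖ₑ).toReal ≤ A := by
    have := ENNReal.toReal_mono ENNReal.ofReal_ne_top hAw
    rwa [ENNReal.toReal_ofReal hA.le] at this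
  set D : ℝ := (2 / Real.sqrt (2 * π)) * A ^ (3 / 2 : ℝ) with hDdef
  have hD : 0 < D := by positivity
  have hweak : ∀ t : ℝ, 0 < t →
      volume {x | t < ‖biotSavart w x‖} ≤ ENNReal.ofReal (D * t ^ (-(3 / 2 : ℝ))) := by
    intro t ht
    refine (meas_biotSavart_gt_le hwm hAtop ht).trans (ENNReal.ofReal_le_ofReal ?_)
    rw [hDdef]
    have h1 : (∫⁻ y, ‖w y‖ₑ).toReal ^ (3 / 2 : ℝ) ≤ A ^ (3 / 2 : ℝ) :=
      Real.rpow_le_rpow ENNReal.toReal_nonneg hA' (by norm_num)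
    have h2 : 0 ≤ t ^ (-(3 / 2 : ℝ)) := Real.rpow_nonneg ht.le _
    have h3 : 0 ≤ 2 / Real.sqrt (2 * π) := by positivity
    gcongr
  refine le_trans (le_of_eq ?_) (lintegral_cube_ge_of_weak hvm hD hweak hX hfloor)
  congr 1
  have hA3 : (A ^ (3 / 2 : ℝ)) ^ 2 = A ^ 3 := by
    rw [← Real.rpow_natCast (A ^ (3 / 2 : ℝ)) 2, ← Real.rpow_mul hA.le,
      show (3 / 2 : ℝ) * ((2 : ℕ) : ℝ) = ((3 : ℕ) : ℝ) by norm_num, Real.rpow_natCast]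
  have hD2 : D ^ 2 = 2 / π * A ^ 3 := by
    rw [hDdef, mul_pow, hA3, div_pow, Real.sq_sqrt (by positivity)]
    field_simp
  rw [hD2]
  field_simp
  ring

/-! ### §3  Along a Tao-class solution -/

section TaoClass

variable {T ν : ℝ} {u₀ : (EuclideanSpace ℝ (Fin 3)) → (EuclideanSpace ℝ (Fin 3))} {u : ℝ → (EuclideanSpace ℝ (Fin 3)) → (EuclideanSpace ℝ (Fin 3))} {p : ℝ → (EuclideanSpace ℝ (Fin 3)) → ℝ}

/-- **The `L³` floor along a Tao-class solution.** If the vorticity slice `ω(t) = curl u(t)` is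
integrable with `∫‖ω(t)‖ ≤ W` (`W > 0`) and the energy slice satisfies `∫|u(t)|² ≥ X > 0`, then
`∫|u(t)|³ ≥ π X³/(512 W³)` (the slice is the Biot–Savart velocity of its vorticity,
`IsTaoSolutionOn.biotSavart_curl_eq`). -/
theorem lintegral_cube_ge_of_energy_of_vorticityMass
    (h : IsTaoSolutionOn T ν u₀ u p) {t : ℝ} (ht : t ∈ Icc 0 T)
    (hint : Integrable (curl (u t))) {W : ℝ} (hW : 0 < W)
    (hWω : ∫ x, ‖curl (u t) x‖ ≤ W) {X : ℝ} (hX : 0 < X)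
    (hfloor : ENNReal.ofReal X ≤ ∫⁻ x, ‖u t x‖ₑ ^ 2) :
    ENNReal.ofReal (π * X ^ 3 / (512 * W ^ 3)) ≤ ∫⁻ x, ‖u t x‖ₑ ^ (3 : ℕ) := by
  have hrep : biotSavart (curl (u t)) = u t := h.biotSavart_curl_eq ht hint
  have hu1 : ContDiff ℝ 1 (u t) := (h.classical.contDiff_velocity ht).of_le (by norm_cast)
  have hwm : Measurable fun y => ‖curl (u t) y‖ₑ := (continuous_curl hu1).measurable.enorm
  have hvm : AEStronglyMeasurable (biotSavart (curl (u t))) volume := by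
    rw [hrep]
    exact (h.classical.contDiff_velocity ht).continuous.aestronglyMeasurable
  have hAw : ∫⁻ y, ‖curl (u t) y‖ₑ ≤ ENNReal.ofReal W := by
    rw [← ofReal_integral_norm_eq_lintegral_enorm hint]
    exact ENNReal.ofReal_le_ofReal hWω
  have hfloor' : ENNReal.ofReal X ≤ ∫⁻ x, ‖biotSavart (curl (u t)) x‖ₑ ^ 2 := by rwa [hrep]
  have := lintegral_cube_biotSavart_ge hwm hvm hW hAw hX hfloor'
  rwa [hrep] at this

/-- **The `L³` floor along a Tao-class solution, norm form**: under the same hypotheses,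
`‖u(t)‖_{L³} ≥ (π X³/(512 W³))^{1/3} = (π/512)^{1/3} X/W`. -/
theorem eLpNorm_three_ge_of_energy_of_vorticityMass
    (h : IsTaoSolutionOn T ν u₀ u p) {t : ℝ} (ht : t ∈ Icc 0 T)
    (hint : Integrable (curl (u t))) {W : ℝ} (hW : 0 < W)
    (hWω : ∫ x, ‖curl (u t) x‖ ≤ W) {X : ℝ} (hX : 0 < X)
    (hfloor : ENNReal.ofReal X ≤ ∫⁻ x, ‖u t x‖ₑ ^ 2) :
    ENNReal.ofReal ((π * X ^ 3 / (512 * W ^ 3)) ^ (1 / 3 : ℝ)) ≤ eLpNorm (u t) 3 volume := by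
  have h3 := lintegral_cube_ge_of_energy_of_vorticityMass h ht hint hW hWω hX hfloor
  rw [eLpNorm_eq_lintegral_rpow_enorm_toReal (by norm_num) (by norm_num)]
  simp only [ENNReal.toReal_ofNat]
  have hL : ∫⁻ x, ‖u t x‖ₑ ^ (3 : ℝ) = ∫⁻ x, ‖u t x‖ₑ ^ (3 : ℕ) := by
    refine lintegral_congr fun x => ?_
    rw [← ENNReal.rpow_natCast]
    norm_num
  rw [hL, ← ENNReal.ofReal_rpow_of_nonneg (by positivity) (by norm_num)]
  exact ENNReal.rpow_le_rpow h3 (by norm_num)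

end TaoClass

/--
info: 'Summit.NavierStokesRegularity.NavierStokesRegularity.Theorems.L3TimeExponentPincerVorticityL3Floor.meas_biotSavart_gt_le' depends on axioms: [propext,
 Classical.choice,
 Quot.sound]
-/
#guard_msgs in
#print axioms meas_biotSavart_gt_le

/--
info: 'Summit.NavierStokesRegularity.NavierStokesRegularity.Theorems.L3TimeExponentPincerVorticityL3Floor.eLpNorm_three_ge_of_energy_of_vorticityMass' depends on axioms: [propext,
 Classical.choice,
 Quot.sound]
-/
#guard_msgs in
#print axioms eLpNorm_three_ge_of_energy_of_vorticityMass

end Summit.NavierStokesRegularity.NavierStokesRegularity.Theorems.L3TimeExponentPincerVorticityL3Floor
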